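import Literature.Topology.FourManifolds.GluckTwist
import Literature.Topology.FourManifolds.GluingUniqueness
import Literature.Topology.FourManifolds.ConnectedSumSphereIdentity
import Literature.Topology.FourManifolds.PalaisBallComplement
import HarnessLib

/-!
# Transport of Gluck twists along diffeomorphisms of `S⁴`; isotopy invariance

First file of the decomposition of the named fact `Literature.Topology.FourManifolds.nonempty_diffeomorph_of_isGluckTwist`
(`GluckTwist.lean`: the Gluck twist `Σ_K` of `S⁴` along a 2-knot `K` depends neither on the
tubular neighbourhood nor on `K` within its ambient isotopy class; H. Gluck, *The embedding of
two-spheres in the four-sphere*, Trans. AMS 104 (1962) 308–333, §8). Everything here is proved.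

Recall (`GluckTwist.lean`) that `IsGluckTwist IX X K` means: for some tubular neighbourhood
`ν : S² × ℝ² → S⁴` of `K`, the manifold `X` is an open gluing (`Literature.Topology.FourManifolds.IsOpenGluing`) of the knot
complement `S⁴ ∖ K(S²)` and `S² × ℝ²` along the relation `gluckRel ν`
(`a = ν (rot_{w/‖w‖} x, w)`, `w ≠ 0`). This file proves the *formal* part of the well-definedness:

* `Literature.SphereEmbedding.map K φ = φ ∘ K`, the image of a sphere embedding under a diffeomorphism
  `φ` of the ambient sphere, the induced diffeomorphism of complements
  `Literature.Topology.FourManifolds.SphereEmbedding.complementCongr`, and `Literature.TwoKnot.TubularNbhd.map ν φ = φ ∘ ν`, the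
  transported tubular neighbourhood;
* `Literature.Topology.FourManifolds.isOpenGluing_gluckRel_map` — if `X` is glued along `gluckRel ν` then `X` is glued along
  `gluckRel (ν.map φ)` (the Gluck relation is natural under diffeomorphisms of `S⁴`; re-gluing
  through diffeomorphisms of the pieces is the tree's `Literature.Topology.FourManifolds.IsOpenGluing.comp_diffeomorph_pieces`,
  `ConnectedSumSphereIdentity.lean`);
* `Literature.Topology.FourManifolds.IsGluckTwist.map`, `Literature.Topology.FourManifolds.IsGluckTwist.of_isIsotopic` — **isotopy invariance of the notion**:
  a Gluck twist of `S⁴` along `K` is a Gluck twist along every 2-knot ambient isotopic to `K`;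
* `Literature.Topology.FourManifolds.nonempty_diffeomorph_of_isOpenGluing_gluckRel` — two Gluck twists formed with the *same*
  tubular neighbourhood are diffeomorphic (uniqueness of open gluings,
  `Literature.Topology.FourManifolds.IsOpenGluing.nonempty_diffeomorph`, Kosinski VI.1);
* `Literature.Topology.FourManifolds.nonempty_diffeomorph_of_isGluckTwist_of_indep` — **reduction** of the named fact to the
  independence of the tubular neighbourhood for one fixed knot: it suffices to know that gluings
  along `gluckRel ν₁`, `gluckRel ν₂` for two tubular neighbourhoods `ν₁`, `ν₂` of the *same* 2-knot
  are diffeomorphic. That remaining statement is the geometric heart (uniqueness of tubular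
  neighbourhoods, Kosinski III.(3.5), and `π₀`-considerations for `Diff(S² × S¹)`, Gluck §8) and
  is treated in the sibling files of this decomposition.

## References

* H. Gluck, *The embedding of two-spheres in the four-sphere*, Trans. Amer. Math. Soc. 104 (1962)
  308–333, §8 [GluckTAMS1962].
* A. Kosinski, *Differential Manifolds*, Academic Press (1993), Ch. VI §1 (gluing), Ch. III §3
  [Kosinski1993].

## Design notes

* Re-gluing through diffeomorphisms of the pieces (`Literature.Topology.FourManifolds.IsOpenGluing.comp_diffeomorph_pieces`)
  is imported from `ConnectedSumSphereIdentity.lean` rather than restated.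
* No statement of `GluckTwist.lean` is modified; no declaration uses `sorry`.
-/

open scoped Manifold ContDiff Topology
open Function Set

noncomputable section

namespace Literature.Topology.FourManifolds

/-- Local notation: `𝔼 n` is the model Euclidean space `EuclideanSpace ℝ (Fin n)`. -/
local notation "𝔼 " n:arg => EuclideanSpace ℝ (Fin n)

/-- Local notation: `𝕊 n` is the unit sphere in `EuclideanSpace ℝ (Fin (n + 1))`. -/
local notation "𝕊 " n:arg => (Metric.sphere (0 : EuclideanSpace ℝ (Fin (n + 1))) 1)

/-! ### Images of sphere embeddings under diffeomorphisms of the ambient sphere -/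

namespace SphereEmbedding

variable {k n : ℕ}

/-- The **image of a sphere embedding under a diffeomorphism of the ambient sphere**:
`K.map φ = φ ∘ K`, again a smooth embedding (`Manifold.IsSmoothEmbedding.diffeomorph_comp`).
If `φ` is the end stage of an ambient isotopy this is, by definition, a knot ambient isotopic to
`K` (`SphereEmbedding.isIsotopic_map`). Rolfsen, *Knots and Links* (1976), §1.A. [folklore] -/
def map (K : SphereEmbedding k n) (φ : (𝕊 n) ≃ₘ⟮𝓡 n, 𝓡 n⟯ (𝕊 n)) : SphereEmbedding k n :=
  ⟨φ ∘ K, K.isSmoothEmbedding.diffeomorph_comp φ⟩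

/-- The image knot as a function. [folklore] -/
@[simp]
theorem coe_map (K : SphereEmbedding k n) (φ : (𝕊 n) ≃ₘ⟮𝓡 n, 𝓡 n⟯ (𝕊 n)) :
    ⇑(K.map φ) = φ ∘ K := rfl

/-- The range of the image knot is the image of the range. [folklore] -/
theorem range_map (K : SphereEmbedding k n) (φ : (𝕊 n) ≃ₘ⟮𝓡 n, 𝓡 n⟯ (𝕊 n)) :
    range (K.map φ) = φ '' range K := by
  rw [coe_map, range_comp]

/-- A point lies in the complement of `K` iff its image lies in the complement of `φ ∘ K`.
[folklore] -/
theorem mem_complement_iff_map (K : SphereEmbedding k n) (φ : (𝕊 n) ≃ₘ⟮𝓡 n, 𝓡 n⟯ (𝕊 n))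
    (x : 𝕊 n) : x ∈ K.complement ↔ φ x ∈ (K.map φ).complement := by
  have hφ : Injective (φ : (𝕊 n) → 𝕊 n) := φ.injective
  simp only [mem_complement_iff, range_map, hφ.mem_set_image]

/-- The diffeomorphism `S ∖ K ≅ S ∖ φ(K)` of knot complements induced by a diffeomorphism `φ` of
the ambient sphere (restriction of `φ` to the open submanifolds). [folklore] -/
def complementCongr (K : SphereEmbedding k n) (φ : (𝕊 n) ≃ₘ⟮𝓡 n, 𝓡 n⟯ (𝕊 n)) :
    K.complement ≃ₘ⟮𝓡 n, 𝓡 n⟯ (K.map φ).complement :=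
  opensCongr φ K.complement (K.map φ).complement (K.mem_complement_iff_map φ)

/-- `complementCongr` acts as `φ`. [folklore] -/
@[simp]
theorem coe_complementCongr_apply (K : SphereEmbedding k n) (φ : (𝕊 n) ≃ₘ⟮𝓡 n, 𝓡 n⟯ (𝕊 n))
    (a : K.complement) : ((K.complementCongr φ a : (K.map φ).complement) : 𝕊 n) = φ a := rfl

/-- `complementCongr⁻¹` acts as `φ⁻¹`. [folklore] -/
@[simp]
theorem coe_complementCongr_symm_apply (K : SphereEmbedding k n)
    (φ : (𝕊 n) ≃ₘ⟮𝓡 n, 𝓡 n⟯ (𝕊 n)) (a : (K.map φ).complement) :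
    (((K.complementCongr φ).symm a : K.complement) : 𝕊 n) = φ.symm a := rfl

/-- The image of `K` under the end stage of an ambient isotopy is ambient isotopic to `K`
(this is the definition of `IsIsotopic`). [folklore] -/
theorem isIsotopic_map (K : SphereEmbedding k n) (F : AmbientIsotopy (𝓡 n) (𝕊 n)) :
    K.IsIsotopic (K.map (F.toDiffeomorph 1)) :=
  ⟨F, rfl⟩

/-- Ambient isotopic sphere embeddings differ by a diffeomorphism of the ambient sphere (the end
stage of the ambient isotopy). [folklore] -/
theorem IsIsotopic.exists_eq_map {K K' : SphereEmbedding k n} (h : K.IsIsotopic K') :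
    ∃ φ : (𝕊 n) ≃ₘ⟮𝓡 n, 𝓡 n⟯ (𝕊 n), K' = K.map φ := by
  obtain ⟨F, hF⟩ := h
  exact ⟨F.toDiffeomorph 1, DFunLike.coe_injective (by rw [coe_map, AmbientIsotopy.coe_toDiffeomorph, hF])⟩

end SphereEmbedding

/-! ### Transport of tubular neighbourhoods -/

namespace TwoKnot.TubularNbhd

variable {K : TwoKnot}

/-- The **transported tubular neighbourhood** `ν.map φ = φ ∘ ν : S² × ℝ² → S⁴` of the image knot
`φ ∘ K`, for a diffeomorphism `φ` of `S⁴` (a smooth embedding followed by a diffeomorphism is a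
smooth embedding). Gluck (1962), §6. [folklore] -/
def map (ν : TwoKnot.TubularNbhd K) (φ : (𝕊 4) ≃ₘ⟮𝓡 4, 𝓡 4⟯ (𝕊 4)) :
    TwoKnot.TubularNbhd (K.map φ) where
  toFun := φ ∘ ν.toFun
  isSmoothEmbedding := ν.isSmoothEmbedding.diffeomorph_comp φ
  apply_zero x := by simp only [comp_apply, ν.apply_zero, SphereEmbedding.coe_map]

/-- The transported tubular neighbourhood as a function. [folklore] -/
@[simp]
theorem map_toFun (ν : TwoKnot.TubularNbhd K) (φ : (𝕊 4) ≃ₘ⟮𝓡 4, 𝓡 4⟯ (𝕊 4)) :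
    (ν.map φ).toFun = φ ∘ ν.toFun := rfl

end TwoKnot.TubularNbhd

/-! ### Naturality of the Gluck relation and isotopy invariance of `IsGluckTwist` -/

section Transport

variable {K : TwoKnot}

/-- **Naturality of the Gluck relation**: under the diffeomorphism of complements induced by `φ`,
the Gluck relation of `ν` corresponds to the Gluck relation of the transported tubular
neighbourhood `φ ∘ ν`: `gluckRel (ν.map φ) a' b ↔ gluckRel ν (φ⁻¹ a') b`. [folklore] -/
theorem gluckRel_map_iff (ν : TwoKnot.TubularNbhd K) (φ : (𝕊 4) ≃ₘ⟮𝓡 4, 𝓡 4⟯ (𝕊 4))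
    (a : (K.map φ).complement) (b : (𝕊 2) × 𝔼 2) :
    gluckRel (ν.map φ) a b ↔ gluckRel ν ((K.complementCongr φ).symm a) b := by
  simp only [gluckRel, TwoKnot.TubularNbhd.map_toFun, comp_apply,
    SphereEmbedding.coe_complementCongr_symm_apply]
  refine and_congr_right fun _ => ⟨fun h => ?_, fun h => ?_⟩
  · rw [h, Diffeomorph.symm_apply_apply]
  · rw [← h, Diffeomorph.apply_symm_apply]

variable {EX HX : Type*} [NormedAddCommGroup EX] [NormedSpace ℝ EX] [TopologicalSpace HX]
  {IX : ModelWithCorners ℝ EX HX} {X : Type*} [TopologicalSpace X] [ChartedSpace HX X]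

/-- **The Gluck gluing is natural under diffeomorphisms of `S⁴`.** If `X` is an open gluing of
`S⁴ ∖ K(S²)` and `S² × ℝ²` along `gluckRel ν`, then `X` is an open gluing of `S⁴ ∖ φ(K(S²))` and
`S² × ℝ²` along `gluckRel (φ ∘ ν)`: precompose the embedding of the complement with
`φ⁻¹ : S⁴ ∖ φ K ≅ S⁴ ∖ K` (`IsOpenGluing.comp_diffeomorph_pieces`). [folklore] -/
theorem isOpenGluing_gluckRel_map {ν : TwoKnot.TubularNbhd K}
    (h : IsOpenGluing (𝓡 4) ((𝓡 2).prod 𝓘(ℝ, 𝔼 2)) IX (A := K.complement) (B := (𝕊 2) × 𝔼 2)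
      (P := X) (gluckRel ν))
    (φ : (𝕊 4) ≃ₘ⟮𝓡 4, 𝓡 4⟯ (𝕊 4)) :
    IsOpenGluing (𝓡 4) ((𝓡 2).prod 𝓘(ℝ, 𝔼 2)) IX (A := (K.map φ).complement) (B := (𝕊 2) × 𝔼 2)
      (P := X) (gluckRel (ν.map φ)) := by
  have h' := h.comp_diffeomorph_pieces (K.complementCongr φ).symm
    (Diffeomorph.refl ((𝓡 2).prod 𝓘(ℝ, 𝔼 2)) ((𝕊 2) × 𝔼 2) ∞)
  have hrel : (fun a b => gluckRel ν ((K.complementCongr φ).symm a)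
      ((Diffeomorph.refl ((𝓡 2).prod 𝓘(ℝ, 𝔼 2)) ((𝕊 2) × 𝔼 2) ∞) b)) = gluckRel (ν.map φ) := by
    funext a b
    rw [gluckRel_map_iff]
    rfl
  rwa [hrel] at h'

/-- **A Gluck twist along `K` is a Gluck twist along `φ ∘ K`** for every diffeomorphism `φ` of
`S⁴` (with the transported tubular neighbourhood `φ ∘ ν`). [folklore] -/
theorem IsGluckTwist.map (h : IsGluckTwist IX X K) (φ : (𝕊 4) ≃ₘ⟮𝓡 4, 𝓡 4⟯ (𝕊 4)) :
    IsGluckTwist IX X (K.map φ) := by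
  obtain ⟨ν, hν⟩ := h
  exact ⟨ν.map φ, isOpenGluing_gluckRel_map hν φ⟩

/-- **Isotopy invariance of the notion of Gluck twist**: if `X` is a Gluck twist of `S⁴` along
`K` and `K'` is ambient isotopic to `K`, then `X` is a Gluck twist of `S⁴` along `K'` (transport
the tubular neighbourhood by the end stage `F₁` of the ambient isotopy, `K' = F₁ ∘ K`). This is
the half of the well-definedness of the Gluck twist (Gluck 1962, §8) that does not involve the
uniqueness of tubular neighbourhoods. [cite: GluckTAMS1962, §8] -/
theorem IsGluckTwist.of_isIsotopic {K' : TwoKnot} (h : IsGluckTwist IX X K)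
    (hK : K.IsIsotopic K') : IsGluckTwist IX X K' := by
  obtain ⟨φ, rfl⟩ := hK.exists_eq_map
  exact h.map φ

end Transport

/-! ### Reduction of the named fact to one knot -/

section Reduction

variable {EX HX HX' : Type*} [NormedAddCommGroup EX] [NormedSpace ℝ EX] [TopologicalSpace HX]
  {IX : ModelWithCorners ℝ EX HX} [TopologicalSpace HX'] {IX' : ModelWithCorners ℝ EX HX'}
  {X X' : Type*} [TopologicalSpace X] [ChartedSpace HX X] [TopologicalSpace X']
  [ChartedSpace HX' X'] {K K' : TwoKnot}

/-- **Two Gluck twists formed with the same tubular neighbourhood are diffeomorphic**: open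
gluings of the same pieces along the same relation are unique up to diffeomorphism
(`IsOpenGluing.nonempty_diffeomorph`; Kosinski, *Differential Manifolds*, VI.1). [cite: Kosinski1993, Ch. VI §1] -/
theorem nonempty_diffeomorph_of_isOpenGluing_gluckRel [IsManifold IX ∞ X] [IsManifold IX' ∞ X']
    {ν : TwoKnot.TubularNbhd K}
    (h : IsOpenGluing (𝓡 4) ((𝓡 2).prod 𝓘(ℝ, 𝔼 2)) IX (A := K.complement) (B := (𝕊 2) × 𝔼 2)
      (P := X) (gluckRel ν))
    (h' : IsOpenGluing (𝓡 4) ((𝓡 2).prod 𝓘(ℝ, 𝔼 2)) IX' (A := K.complement) (B := (𝕊 2) × 𝔼 2)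
      (P := X') (gluckRel ν)) :
    Nonempty (X ≃ₘ⟮IX, IX'⟯ X') :=
  IsOpenGluing.nonempty_diffeomorph h h'

/-- **Reduction of `nonempty_diffeomorph_of_isGluckTwist` to a fixed knot.** The named fact
(Gluck twists along ambient isotopic knots are diffeomorphic, for all tubular neighbourhoods)
follows as soon as, for the single knot `K'`, open gluings along `gluckRel ν₁` and `gluckRel ν₂`
are diffeomorphic for any two tubular neighbourhoods `ν₁`, `ν₂` of `K'`: by
`IsGluckTwist.of_isIsotopic` a Gluck twist along `K` is one along `K'`. The hypothesis is the
independence of the Gluck twist from the tubular neighbourhood (Gluck 1962, §8; uniqueness of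
tubular neighbourhoods, Kosinski III.(3.5)), treated in the sibling files. [cite: GluckTAMS1962, §8] -/
theorem nonempty_diffeomorph_of_isGluckTwist_of_indep
    (H : ∀ ν₁ ν₂ : TwoKnot.TubularNbhd K', ∀ [IsManifold IX ∞ X] [IsManifold IX' ∞ X'],
      IsOpenGluing (𝓡 4) ((𝓡 2).prod 𝓘(ℝ, 𝔼 2)) IX (A := K'.complement) (B := (𝕊 2) × 𝔼 2)
        (P := X) (gluckRel ν₁) →
      IsOpenGluing (𝓡 4) ((𝓡 2).prod 𝓘(ℝ, 𝔼 2)) IX' (A := K'.complement) (B := (𝕊 2) × 𝔼 2)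
        (P := X') (gluckRel ν₂) → Nonempty (X ≃ₘ⟮IX, IX'⟯ X')) :
    nonempty_diffeomorph_of_isGluckTwist (IX := IX) (IX' := IX') (X := X) (X' := X') (K := K)
      (K' := K') := by
  intro _ _ h h' hK
  obtain ⟨ν₁, h₁⟩ := h.of_isIsotopic hK
  obtain ⟨ν₂, h₂⟩ := h'
  exact H ν₁ ν₂ h₁ h₂

end Reduction

end Literature.Topology.FourManifolds

end
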